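import Literature.Analysis.FluidPDE.LerayHopf
import Literature.Analysis.FluidPDE.SuitableWeak
import Literature.Analysis.FluidPDE.AxisymmetricEuler
import Literature.Analysis.FunctionSpaces.WeakLp
import HarnessLib

/-!
# Barker–Fernández-Dalgo–Prange 2023: blow-up of the `L³` norm restricted to the exterior of the
# backward paraboloid `|x| = √(a(T−t))` at a first-time singularity (weak `L³` if axisymmetric)

Topic `Analysis/FluidPDE`. Source: T. Barker, P. G. Fernández-Dalgo, C. Prange, *Blow-up of
dynamically restricted critical norms near a potential Navier–Stokes singularity*, Math. Ann. 389
(2024) 1517–1543, doi:10.1007/s00208-023-02675-x = arXiv:2302.06509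
[`BarkerFernandezDalgoPrange2023`]; read in the arXiv version (held text `paper:arxiv-2302.06509`),
§1 (p. 3: the footnoted definitions of singular point and first-time singularity, **Theorem 1**,
the constant `a = λ_S(B₀(1)) > π`, the three remarks). One file for §1 (D-0064).

## The printed statement (unit viscosity, no force)

**Theorem 1.** "Let `v` be a finite-energy weak solution to the Navier–Stokes equations in
`ℝ³ × (−1,0)` such that `0` is a first-time singularity [footnote: In particular,
`v ∈ C^∞(−1,T; C^∞(ℝ³))` for all `T ∈ (−1,0)`. We introduce this assumption in order to remove
certain technicalities]. Assume `(0,0)` is a singular point [footnote: for all `r ∈ (0,1)`,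
`v ∉ L^∞(Q_{(0,0)}(r))`, `Q_{(0,0)}(r) = B₀(r) × (−r²,0)`]. Then
`limsup_{t→0} ‖v(·,t)‖_{L³(B₀(√a) ∖ B₀(√(−at)))} = ∞`. If in addition, the solution is axisymmetric,
then `limsup_{t→0} ‖v(·,t)‖_{L^{3,∞}(B₀(√a) ∖ B₀(√(−at)))} = ∞`. Here, and throughout the paper,
`a := λ_S(B₀(1)) > π`, where `λ_S(B₁)` is the first eigenvalue of the Dirichlet–Stokes operator on
`B₀(1)`." (Remark: "stated in the global setting for first-time singularities of Leray–Hopf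
solutions". The endpoint `p = 3`, `q = ∞` of Neustupa's dynamically restricted
Ladyženskaja–Prodi–Serrin criteria; generalizes the ESŠ `L³` criterion — the tree's `ess_endpoint`,
`seregin_L3_blowup`.)

## Contents (named facts, D-0014)

* `bfp2023_hollowed_L3_blowup` — Theorem 1, first assertion.
* `bfp2023_hollowed_weakL3_blowup_axisym` — Theorem 1, axisymmetric assertion.

## Transcription notes (never stronger than print)

* *Class.* "Finite-energy weak (= Leray–Hopf) solution in `ℝ³ × (−1,0)`, smooth on every
  `(−1,T) × ℝ³`, `T < 0`" = on the tree's frame `[0,T]`: `IsLerayHopfOn T ν 0 u₀ u` and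
  `IsClassicalNSSolutionOn (Ioo 0 T) ν 0 u p` (then every point of the open slab is regular by
  continuity, so `T` is a first-time singularity as soon as some `(T,x₀)` is singular). *Singular
  point at `(T,x₀)`* = essential unboundedness of `uncurry u` on every backward cylinder
  `parabolicCylinder r (T,x₀) = (T−r², T) × B_r(x₀)` with `0 < r`, `r² < T` (the footnoted
  definition; the convention of `BarkerPrange2020_thm2`). `limsup = ∞` is recorded as: for every
  `A`, frequently as `t ↑ T`, `A < ‖u(t)‖` (in `ℝ≥0∞`), the norm being `eLpNorm` of the slice on the
  restricted measure of the annulus, resp. the weak-`L³` quasi-norm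
  `eWeakLpPow (u t) 3 (volume.restrict ·)`
  (`‖g‖³_{L^{3,∞}(Ω)} = sup_α α³ d_{g,Ω}(α)`, Appendix A of the source).
* *The constant `a`.* The tree has no Dirichlet–Stokes eigenvalue; the printed `a = λ_S(B₀(1)) > π`
  is recorded as `∃ a, π < a ∧ …` (weaker than print, which names `a`).
* *Centre, scale, viscosity.* Printed at the singular point `(0,0)` on `ℝ³ × (−1,0)` with `ν = 1`.
  Recorded at a singular point `(T,x₀)` of a viscosity-`ν` solution on `[0,T]` and at every
  admissible scale `0 < ℓ ≤ √(νT)`, through `w(y,s) = (ℓ/ν) u(x₀ + ℓy, T + ℓ²s/ν)` (a unit-viscosity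
  finite-energy weak solution on `(−νT/ℓ², 0) ⊇ (−1,0)`, smooth before `0`, singular at `(0,0)`;
  spatial translation is a symmetry of the class — for the axisymmetric clause `x₀` is taken ON the
  symmetry axis, so that the translate is still axisymmetric about the `x₃`-axis):
  `‖w(s)‖_{L³(√(−as) ≤ |y| < √a)} = ν⁻¹ ‖u(t)‖_{L³(√(aν(T−t)) ≤ |x−x₀| < ℓ√a)}` and likewise for the
  weak-`L³` quasi-norm (both scale invariant), so `limsup = ∞` transfers verbatim. For `ν = 1`,
  `T = 1`, `ℓ = 1`, `x₀ = 0` the recorded statements are literally the printed ones (time-translated).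
  The annulus `B₀(R) ∖ B₀(ρ)` is `{ρ ≤ |x| < R}`.
* Not here: the localized (suitable weak) version mentioned in the first remark, Props 3.1/5.1 and
  the proofs (§§2–4), the admissible range `a < (4/3)λ_S(B₀(1))` of the footnote.

## Mathlib / tree search

`lean search 'hollowed|dynamically restricted|2302.06509|paraboloid.*L3'`: no transcription
(2026-08-26). Related: `ess_endpoint`, `seregin_L3_blowup` (proved), `BarkerPrange2020_thm2`
(concentration INSIDE balls `|x| ≤ C√(T−t)`; the present result is the complementary exterior
statement). Reused: `IsLerayHopfOn`, `IsClassicalNSSolutionOn`, `parabolicCylinder`,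
`IsAxisymmetric` (`AxisymmetricEuler.lean`), `FunctionSpaces.eWeakLpPow`. Mathlib has no
Navier–Stokes notions and no Stokes-operator spectrum on domains.

## References

* T. Barker, P. G. Fernández-Dalgo, C. Prange, Math. Ann. 389 (2024) = arXiv:2302.06509: §1 p. 3
  (Thm 1 with footnotes 1–3). [`BarkerFernandezDalgoPrange2023`]
* J. Neustupa, Arch. Ration. Mech. Anal. 214 (2014) (the non-endpoint dynamically restricted
  criteria quoted in §1).
-/

noncomputable section

open MeasureTheory Set Function Metric Filter
open _root_.Topology
open scoped ENNReal

namespace Literature.Analysis.FluidPDE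

/-- **Barker–Fernández-Dalgo–Prange 2023, Theorem 1 (first assertion): the `L³` norm outside the
backward paraboloid blows up.** There is `a > π` (printed: `a = λ_S(B₀(1))`, the first
Dirichlet–Stokes eigenvalue of the unit ball) such that for every viscosity `ν > 0` and `T > 0`: if
`(u,p)` is a smooth solution of the unforced Navier–Stokes equations on the open slab `(0,T) × ℝ³`
which is a finite-energy (Leray–Hopf) solution on `[0,T]`, and `(T,x₀)` is a singular point (`u`
essentially unbounded on every backward cylinder `(T−r², T) × B_r(x₀)`, `0 < r`, `r² < T`), then
for every scale `0 < ℓ ≤ √(νT)`,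
`limsup_{t↑T} ‖u(t)‖_{L³({√(aν(T−t)) ≤ |x−x₀| < ℓ√a})} = ∞` (recorded: for every `A`, frequently as
`t ↑ T`, the norm exceeds `A`). Printed for `ν = 1` on `ℝ³ × (−1,0)` at `(0,0)`:
`limsup_{t→0} ‖v(·,t)‖_{L³(B₀(√a) ∖ B₀(√(−at)))} = ∞`; general frame by translation and scaling
(module docstring). [cite: BarkerFernandezDalgoPrange2023, Thm. 1 (arXiv:2302.06509 §1 p. 3)] -/
def bfp2023_hollowed_L3_blowup : Prop :=
  ∃ a : ℝ, Real.pi < a ∧ ∀ (ν T : ℝ), 0 < ν → 0 < T →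
    ∀ (u₀ : EuclideanSpace ℝ (Fin 3) → EuclideanSpace ℝ (Fin 3))
      (u : ℝ → EuclideanSpace ℝ (Fin 3) → EuclideanSpace ℝ (Fin 3))
      (p : ℝ → EuclideanSpace ℝ (Fin 3) → ℝ),
      IsClassicalNSSolutionOn (Ioo 0 T) ν 0 u p → IsLerayHopfOn T ν 0 u₀ u →
      ∀ x₀ : EuclideanSpace ℝ (Fin 3),
        (∀ r : ℝ, 0 < r → r ^ 2 < T →
          eLpNorm (uncurry u) ∞ (volume.restrict (parabolicCylinder r (T, x₀))) = ∞) →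
        ∀ ℓ : ℝ, 0 < ℓ → ℓ ≤ Real.sqrt (ν * T) →
          ∀ A : ℝ, ∃ᶠ t in 𝓝[<] T,
            ENNReal.ofReal A <
              eLpNorm (u t) 3 (volume.restrict
                {x : EuclideanSpace ℝ (Fin 3) |
                  Real.sqrt (a * ν * (T - t)) ≤ dist x x₀ ∧ dist x x₀ < ℓ * Real.sqrt a})

/-- **Barker–Fernández-Dalgo–Prange 2023, Theorem 1 (axisymmetric assertion): the weak-`L³`
quasi-norm outside the backward paraboloid blows up.** With `a > π` as above (recorded
existentially; one `a` serves both assertions in print, here each fact carries its own), for every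
`ν > 0`, `T > 0`: if `(u,p)` is a smooth solution on `(0,T) × ℝ³`, Leray–Hopf on `[0,T]`, with every
slice `u(t)`, `0 < t < T`, axisymmetric about the `x₃`-axis (`IsAxisymmetric`), and `(T,x₀)` is a
singular point lying ON the axis (`x₀` has vanishing first two coordinates), then for every scale
`0 < ℓ ≤ √(νT)` and every `A`, frequently as `t ↑ T`,
`A < sup_{α>0} α³ |{x : √(aν(T−t)) ≤ |x−x₀| < ℓ√a, α < |u(t,x)|}|` — i.e.
`limsup_{t↑T} ‖u(t)‖_{L^{3,∞}({√(aν(T−t)) ≤ |x−x₀| < ℓ√a})} = ∞`. Printed for `ν = 1` at `(0,0)`: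
`limsup_{t→0} ‖v(·,t)‖_{L^{3,∞}(B₀(√a) ∖ B₀(√(−at)))} = ∞` (module docstring for the frame). [cite: BarkerFernandezDalgoPrange2023, Thm. 1 (arXiv:2302.06509 §1 p. 3), axisymmetric case] -/
def bfp2023_hollowed_weakL3_blowup_axisym : Prop :=
  ∃ a : ℝ, Real.pi < a ∧ ∀ (ν T : ℝ), 0 < ν → 0 < T →
    ∀ (u₀ : EuclideanSpace ℝ (Fin 3) → EuclideanSpace ℝ (Fin 3))
      (u : ℝ → EuclideanSpace ℝ (Fin 3) → EuclideanSpace ℝ (Fin 3))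
      (p : ℝ → EuclideanSpace ℝ (Fin 3) → ℝ),
      IsClassicalNSSolutionOn (Ioo 0 T) ν 0 u p → IsLerayHopfOn T ν 0 u₀ u →
      (∀ t ∈ Ioo 0 T, IsAxisymmetric (u t)) →
      ∀ x₀ : EuclideanSpace ℝ (Fin 3), x₀ 0 = 0 → x₀ 1 = 0 →
        (∀ r : ℝ, 0 < r → r ^ 2 < T →
          eLpNorm (uncurry u) ∞ (volume.restrict (parabolicCylinder r (T, x₀))) = ∞) →
        ∀ ℓ : ℝ, 0 < ℓ → ℓ ≤ Real.sqrt (ν * T) →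
          ∀ A : ℝ, ∃ᶠ t in 𝓝[<] T,
            ENNReal.ofReal A <
              FunctionSpaces.eWeakLpPow (u t) 3 (volume.restrict
                {x : EuclideanSpace ℝ (Fin 3) |
                  Real.sqrt (a * ν * (T - t)) ≤ dist x x₀ ∧ dist x x₀ < ℓ * Real.sqrt a})

end Literature.Analysis.FluidPDE

end
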